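import Literature.Geometry.Lorentzian.KerrDataSchwarzschildExtrinsic
import HarnessLib

/-!
# Rigidity of the unit normal and of the second fundamental form of the Schwarzschild
# Kerr–Schild slice (support file, all results proved)

Companion of `KerrDataSchwarzschildExtrinsic.lean` (Cook's closed form `kRep` of the second
fundamental form of the slice `{t* = 0}` of Schwarzschild in ingoing Kerr–Schild coordinates).
Two rigidity statements used when a hypersurface is only known to COINCIDE LOCALLY with the
Kerr–Schild slice (e.g. the bent Kerr–Schild/Boyer–Lindquist slices of the `FinalStateConjecture`
routes, which are `{t* = 0}` near the horizon):

* `Kerr.eq_sliceNormalRep` — **uniqueness of the future unit normal**: at `(0, y)`, `y ≠ 0`,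
  `M ≥ 0`, a vector `n` which is `g_{M,0}`-orthogonal to every slice direction `(0, w)`, has
  `g(n, n) = −1` and `g(V, n) < 0` for the time-orientation field `V = −g♯dt*`, IS the normal
  `sliceNormalRep M y = (1 + 2H)^{-1/2} V` (decompose `n = αV + (0, w₀)`; `g` is positive definite
  on slice directions (`Kerr.bilin_zero_ofTimeSpace`, `hRep`), so `w₀ = 0`; unit length and
  future direction pin `α`). Cook, Living Rev. Relativ. 3 (2000) 5, §3.2.2 (lapse and shift of
  Kerr–Schild slices); O'Neill 1983, Ch. 5, Lemma 5.26.
* `Kerr.secondFundamentalForm_eq_half_of_repr`, `Kerr.secondFundamentalForm_eq_kRep_of_repr` —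
  **the second fundamental form of ANY map `f : Kerr.slice 0 r₁ → Kerr.region 0 r₁` with ANY
  field `ν` along it whose coordinate representatives agree TO FIRST ORDER at the point `y` with
  the slice embedding `z ↦ (0, z)` and the normal `sliceNormalRep M`** is Cook's closed form:
  `K(v, w) = kRep M y v w`. This is the tree's `Kerr.secondFundamentalForm_zero_eq_half` /
  `Kerr.data_k_zero_apply` with the global hypotheses `f = sliceEmbed`, `ν = sliceNormal`
  replaced by first-order agreement at `y` (all that `OpensChart.secondFundamentalForm_eq_of_repr`
  consumes), and WITHOUT the instance hypothesis `[Kerr.SliceFacts]`: any Levi-Civita instance of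
  the smooth Kerr metric may be supplied (e.g. `PseudoRiemannianMetric.hasLeviCivita`).
  O'Neill 1983, Ch. 3, Prop. 3.13 and Ch. 4, Lemma 4.1/4.4; Wald 1984, (10.2.13); Cook 2000, (57).

Refuter seat cdisprove-stmt-FinalStateConjecture-10052 (support lemmas of the disproof file of
crux `ParametricKerrBurial`, route SwallowTheDatum), 2026-08-15.

## References

* G. B. Cook, *Initial data for numerical relativity*, Living Rev. Relativ. 3 (2000) 5, §3.2.2,
  (56)–(57).
* B. O'Neill, *Semi-Riemannian geometry* (1983), Ch. 3, Prop. 3.13; Ch. 4, Lemma 4.1, 4.4;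
  Ch. 5, Lemma 5.26.
* R. M. Wald, *General Relativity* (1984), (10.2.13).
-/

noncomputable section

-- instance search through the nested operator types `E4 →L E4 →L E4 →L ℝ` (as in `ChartCurvature`)
set_option maxSynthPendingDepth 3

open Bundle TopologicalSpace Manifold Set Module Filter
open scoped ContDiff Topology InnerProductSpace

namespace Literature.Geometry.Lorentzian

namespace Kerr

/-- **Uniqueness of the future unit normal** of `{t* = 0}` at `(0, y)`, `a = 0`: `n ⊥ (0, w)`
for all `w`, `g(n, n) = −1`, `g(V, n) < 0` (`V = −g♯dt*`) force `n = (1 + 2H)^{-1/2} V`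
(write `n = αV + (0, w₀)`; `g` is positive on slice directions, so `w₀ = 0`).
Cook 2000, §3.2.2; O'Neill 1983, Ch. 5, Lemma 5.26. [cite: Cook2000, §3.2.2] -/
theorem eq_sliceNormalRep {M : ℝ} (hM : 0 ≤ M) {y : E3} (hy : y ≠ 0) {n : E4}
    (hn : ∀ w : E3, Kerr.bilin M 0 (E4.ofTimeSpace 0 y) n (E4.ofTimeSpace 0 w) = 0)
    (hu : Kerr.bilin M 0 (E4.ofTimeSpace 0 y) n n = -1)
    (hf : Kerr.bilin M 0 (E4.ofTimeSpace 0 y)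
      (Kerr.timeVector M 0 (E4.ofTimeSpace 0 y)) n < 0) :
    n = Kerr.sliceNormalRep M y := by
  set x : E4 := E4.ofTimeSpace 0 y with hxdef
  have hx : 0 < Kerr.radius 0 x := by
    rw [hxdef, Kerr.radius_zero_ofTimeSpace]; exact norm_pos_iff.2 hy
  set H : ℝ := Kerr.scalarH M 0 x with hHdef
  set V : E4 := Kerr.timeVector M 0 x with hVdef
  have hH : 0 ≤ H := Kerr.scalarH_nonneg hM 0 x
  have hV1 : ∀ w : E4, Kerr.bilin M 0 x V w = -w 0 := fun w ↦ Kerr.bilin_timeVector hx w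
  have hV2 : Kerr.bilin M 0 x V V = -1 - 2 * H := Kerr.bilin_timeVector_timeVector hx
  have hV0 : V 0 = 1 + 2 * H := by have := hV1 V; rw [hV2] at this; linarith
  have h12 : (0 : ℝ) < 1 + 2 * H := by positivity
  set α : ℝ := n 0 / (1 + 2 * H) with hαdef
  set B : E4 := n - α • V with hBdef
  have hB0 : B 0 = 0 := by
    simp only [hBdef, PiLp.sub_apply, PiLp.smul_apply, smul_eq_mul, hV0, hαdef]
    field_simp; ring
  have hB : E4.ofTimeSpace 0 (E4.spatial B) = B := by
    have := E4.ofTimeSpace_time_spatial B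
    rwa [E4.time_apply, hB0] at this
  have hnB : Kerr.bilin M 0 x n B = 0 := by rw [← hB]; exact hn _
  have hVB : Kerr.bilin M 0 x V B = 0 := by rw [hV1, hB0, neg_zero]
  have hBB : Kerr.bilin M 0 x B B = 0 := by
    have e : Kerr.bilin M 0 x (n - α • V) B = 0 := by
      have h1 : Kerr.bilin M 0 x (n - α • V) B =
          Kerr.bilin M 0 x n B - α * Kerr.bilin M 0 x V B := by
        simp only [map_sub, map_smul]; rfl
      rw [h1, hnB, hVB]; ring
    rwa [← hBdef] at e
  have hsB : E4.spatial B = 0 := by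
    have hpos := Kerr.bilin_zero_ofTimeSpace M hy (E4.spatial B) (E4.spatial B)
    rw [hB] at hpos
    rw [hpos, Kerr.hRep_apply, real_inner_self_eq_norm_sq] at hBB
    have h1 : 0 ≤ 2 * M / ‖y‖ ^ 3 * (⟪y, E4.spatial B⟫_ℝ * ⟪y, E4.spatial B⟫_ℝ) := by
      have := norm_nonneg y
      have h2 : 0 ≤ ⟪y, E4.spatial B⟫_ℝ * ⟪y, E4.spatial B⟫_ℝ := mul_self_nonneg _
      positivity
    have h3 : ‖E4.spatial B‖ ^ 2 = 0 := by nlinarith [sq_nonneg ‖E4.spatial B‖]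
    exact norm_eq_zero.1 (pow_eq_zero_iff two_ne_zero |>.1 h3)
  have hBzero : B = 0 := by rw [← hB, hsB]; exact map_zero Kerr.sliceEmbedCLM
  have hnV : n = α • V := sub_eq_zero.1 hBzero
  have hαsq : α ^ 2 * (1 + 2 * H) = 1 := by
    rw [hnV] at hu
    simp only [map_smul, FunLike.coe_smul, Pi.smul_apply, smul_eq_mul, hV2] at hu
    nlinarith [hu]
  have hαpos : 0 < α := by
    rw [hnV] at hf
    simp only [map_smul, smul_eq_mul, hV2] at hf
    nlinarith [hf, h12]
  have hα : α = (√(1 + 2 * H))⁻¹ := by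
    rw [← Real.sqrt_inv]
    have : (1 + 2 * H)⁻¹ = α ^ 2 := by
      rw [eq_comm, ← one_div, eq_div_iff h12.ne']
      exact hαsq
    rw [this, Real.sqrt_sq hαpos.le]
  rw [hnV, hα]
  rfl

/-- **`K` through `∂g`** for ANY map `f : slice 0 r₁ → region 0 r₁` and field `ν` whose
representatives agree to first order at `y` with the Kerr–Schild slice embedding and its normal:
`K(v, w) = ½ ((∂_N g)(w̃, ṽ) − (∂_ṽ g)(N, w̃) − (∂_w̃ g)(ṽ, N))` (the tree's
`Kerr.secondFundamentalForm_zero_eq_half` without `SliceFacts`).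
[cite: ONeill1983, Ch. 4, Lemma 4.4] -/
theorem secondFundamentalForm_eq_half_of_repr [Facts] {M r₁ : ℝ} (hM : 0 ≤ M)
    [(Kerr.smoothMetric M 0 r₁).HasLeviCivita]
    {f : Kerr.slice 0 r₁ → Kerr.region 0 r₁} {Φ : E3 → E4} (hf : ∀ y, (f y : E4) = Φ y)
    {ν : NormalField 𝓘(ℝ, E4) f} {N : E3 → E4} (hν : ∀ y, ν y = N y)
    {y : Kerr.slice 0 r₁} (hΦd : DifferentiableAt ℝ Φ y) (hNd : DifferentiableAt ℝ N y)
    (hfy : f y = Kerr.sliceEmbed 0 r₁ y)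
    (hΦ' : ∀ v : E3, fderiv ℝ Φ y v = E4.ofTimeSpace 0 v)
    (hNy : N y = Kerr.sliceNormalRep M y)
    (hN' : fderiv ℝ N y = fderiv ℝ (Kerr.sliceNormalRep M) y) (v w : E3) :
    (Kerr.smoothMetric M 0 r₁).secondFundamentalForm 𝓘(ℝ, E3) f ν y v w =
      2⁻¹ * (fderiv ℝ (Kerr.bilin M 0) (E4.ofTimeSpace 0 y) (Kerr.sliceNormalRep M y)
            (E4.ofTimeSpace 0 w) (E4.ofTimeSpace 0 v)
          - fderiv ℝ (Kerr.bilin M 0) (E4.ofTimeSpace 0 y) (E4.ofTimeSpace 0 v)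
            (Kerr.sliceNormalRep M y) (E4.ofTimeSpace 0 w)
          - fderiv ℝ (Kerr.bilin M 0) (E4.ofTimeSpace 0 y) (E4.ofTimeSpace 0 w)
            (E4.ofTimeSpace 0 v) (Kerr.sliceNormalRep M y)) := by
  have hy : (y : E3) ≠ 0 := Kerr.ne_zero_of_mem_slice_zero y
  rw [OpensChart.secondFundamentalForm_eq_of_repr
    (g := (Kerr.smoothMetric M 0 r₁).toPseudoRiemannianMetric)
    (G := Kerr.bilin M 0) (Kerr.smoothMetric_val M 0 r₁) hf hν hΦd hNd
    (Kerr.differentiableAt_bilin M 0 _) v w, hN', hNy, hΦ', hΦ', hfy]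
  -- the Christoffel symbols of the first kind: `g(Γ(N)(ṽ), w̃) = ½ K(N, ṽ, w̃)`
  have hΓ := OpensChart.val_christoffel_const
    (g := (Kerr.smoothMetric M 0 r₁).toPseudoRiemannianMetric)
    (G := Kerr.bilin M 0) (Kerr.sliceEmbed 0 r₁ y) (Kerr.sliceNormalRep M y)
    (E4.ofTimeSpace 0 v) (E4.ofTimeSpace 0 w)
  have hΓ' : Kerr.bilin M 0 (E4.ofTimeSpace 0 y) (OpensChart.christoffel
      (Kerr.smoothMetric M 0 r₁).toPseudoRiemannianMetric (Kerr.bilin M 0)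
      (Kerr.sliceEmbed 0 r₁ y) (Kerr.sliceNormalRep M y) (E4.ofTimeSpace 0 v))
      (E4.ofTimeSpace 0 w) =
      2⁻¹ * OpensChart.koszulForm (Kerr.bilin M 0) (E4.ofTimeSpace 0 y)
        (Kerr.sliceNormalRep M y) (E4.ofTimeSpace 0 v) (E4.ofTimeSpace 0 w) := hΓ
  show Kerr.bilin M 0 (E4.ofTimeSpace 0 y) (fderiv ℝ (Kerr.sliceNormalRep M) y v +
      OpensChart.christoffel (Kerr.smoothMetric M 0 r₁).toPseudoRiemannianMetric
      (Kerr.bilin M 0) (Kerr.sliceEmbed 0 r₁ y) (Kerr.sliceNormalRep M y)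
      (E4.ofTimeSpace 0 v)) (E4.ofTimeSpace 0 w) = _
  rw [map_add, _root_.add_apply, hΓ', OpensChart.koszulForm_apply,
    Kerr.bilin_fderiv_sliceNormalRep hM hy v w]
  ring

/-- … and in closed form: `K(v, w) = kRep M y v w` (Cook's formula (57)), adapted from the tree's
`Kerr.data_k_zero_apply` without the `SliceFacts` hypothesis. [cite: Cook2000, §3.2.2 (57)] -/
theorem secondFundamentalForm_eq_kRep_of_repr [Facts] {M r₁ : ℝ} (hM : 0 ≤ M)
    [(Kerr.smoothMetric M 0 r₁).HasLeviCivita]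
    {f : Kerr.slice 0 r₁ → Kerr.region 0 r₁} {Φ : E3 → E4} (hf : ∀ y, (f y : E4) = Φ y)
    {ν : NormalField 𝓘(ℝ, E4) f} {N : E3 → E4} (hν : ∀ y, ν y = N y)
    {y : Kerr.slice 0 r₁} (hΦd : DifferentiableAt ℝ Φ y) (hNd : DifferentiableAt ℝ N y)
    (hfy : f y = Kerr.sliceEmbed 0 r₁ y)
    (hΦ' : ∀ v : E3, fderiv ℝ Φ y v = E4.ofTimeSpace 0 v)
    (hNy : N y = Kerr.sliceNormalRep M y)
    (hN' : fderiv ℝ N y = fderiv ℝ (Kerr.sliceNormalRep M) y) (v w : E3) :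
    (Kerr.smoothMetric M 0 r₁).secondFundamentalForm 𝓘(ℝ, E3) f ν y v w =
      Kerr.kRep M y v w := by
  have hy : (y : E3) ≠ 0 := Kerr.ne_zero_of_mem_slice_zero y
  have hr : ‖(y : E3)‖ ≠ 0 := norm_ne_zero_iff.2 hy
  have hsp : E4.spatial (E4.ofTimeSpace 0 (y : E3)) ≠ 0 := by rwa [E4.spatial_ofTimeSpace]
  have hS : √(1 + 2 * M / ‖(y : E3)‖) ≠ 0 :=
    (Real.sqrt_pos.2 (by have := Kerr.norm_pos_of_mem_slice_zero y; positivity)).ne'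
  rw [secondFundamentalForm_eq_half_of_repr hM hf hν hΦd hNd hfy hΦ' hNy hN' v w]
  have h1 : ⟪v, (y : E3)⟫_ℝ = ⟪(y : E3), v⟫_ℝ := real_inner_comm _ _
  have h2 : ⟪w, (y : E3)⟫_ℝ = ⟪(y : E3), w⟫_ℝ := real_inner_comm _ _
  have h3 : ⟪w, v⟫_ℝ = ⟪v, w⟫_ℝ := real_inner_comm _ _
  simp only [Kerr.fderiv_bilin_zero_apply M hsp, Kerr.bilinZeroDeriv_apply,
    Kerr.nullCovectorZero_apply, Kerr.nullCovectorZeroDeriv_apply, E4.spatial_ofTimeSpace,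
    E4.ofTimeSpace_apply_zero, Kerr.sliceNormalRep_apply_zero M hy,
    Kerr.spatial_sliceNormalRep M hy, inner_smul_left, inner_smul_right,
    real_inner_self_eq_norm_sq, Kerr.kRep]
  simp only [h1, h2, h3, conj_trivial]
  field_simp
  ring

end Kerr

end Literature.Geometry.Lorentzian

end
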